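import Mathlib
import Literature.MathematicalPhysics.QuantumFieldTheory.Balaban1983to89.B9Thm314
import Literature.MathematicalPhysics.QuantumFieldTheory.Balaban1983to89.B9FromB6

/-!
# `Balaban1983to89.B9Thm314Unrestricted` — [Balaban1985BackgroundPropagators] Theorem 3.14 (pp. 426–427): the typed reading WITHOUT the printed
# localisation restriction «y, y′ ∈ Ω^{(k)}» (`B9.Thm314Printed`, the `t314` field of the DAG leaf `DagBinding.B9LeafX`) FOLLOWS from the printed,
# restricted reading (`B9Thm314.Thm314SupOn`, the sup part of the leaf's `t314loc` field) — kernel-checked bookkeeping, [folklore] arithmetic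

B9 = T. Bałaban, *Propagators for lattice gauge theories in a background field*, Commun. Math. Phys. **99** (1985) 389–434
[Balaban1985BackgroundPropagators] (journal page = PDF page + 388).  p. 426 [PDF 38]: *"Let us take localizations determined by points
y, y′ ∈ Ω^{(k)} …"*; Theorem 3.14: *"If we take a pair of operators constructed for the two sequences {Ω_j}, {Ω′_j}, then their difference satisfies
all the inequalities characteristic for operators of the considered type, with the additional factor exp(−δ₀d(y, y′, Ω)),
d(y, y′, Ω) = inf_{y₁∈Ωᶜ∩T^{(k)}}(|y − y₁| + |y₁ − y′|) (3.154) on the right-hand sides."*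

CONTEXT (YM-PLAN Track A, DAG node N06, seat `pub-ymgap-dag-n06-a`; the located TYPED-LEAF FLAG of the N06 dossier §7, pub-ymgap INBOX
[DAGN06A-G0-FLAG-T314] ∕ lit-balaban [DESK-ANSWER N06]): the leaf field `B9LeafX.numbered.t314 : B9.Thm314Printed …` reads Theorem 3.14 (i) WITHOUT
the printed restriction y, y′ ∈ Ω^{(k)} (`B9Thm314.thm314Printed_iff_supOn_univ`) and (ii) with an M-UNIFORM constant ∕ rate.  THIS MODULE SETTLES
PART (i) OF THE FLAG IN THE KERNEL: the unrestricted reading is NOT stronger than the restricted one modulo two located inputs a pin supplies —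
(β) the PLAIN characteristic sup bound for the difference operator WITHOUT the extra factor (at Bałaban's objects: Theorem 3.1 for each of the two
operators and the triangle inequality — the difference of two operators each obeying (3.42) obeys (3.42) with the constant doubled), and
(γ) the GEOMETRY OF (3.154) OFF THE RESTRICTION: if y or y′ is not a point of Ω^{(k)}, then d(y, y′, Ω) ≤ d(y, y′) + r for a fixed r (a site of 𝔅 outside
Ω^{(k)} lies outside Ω — Λ_j ⊂ Ω_j ∖ Ω_{j+1} ⊂ Ωᶜ for j < k, Λ_k ∖ Ω^{(k)} ⊂ Ωᶜ — so the infimum in (3.154) may be taken at the `k`-lattice point y₁ of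
its own `k`-block, |y − y₁| ≤ r∕2, and |y₁ − y′| ≤ |y₁ − y| + |y − y′| ≤ r∕2 + d(y, y′) since the lattice distance is dominated by the multiscale
distance d of [4] (2.46), `B9Thm314.LocData.Laws`; on the tree's flat model: `B9Thm314GpFlatTorusGeometry.blk_mem_OmegaC`, `dOmega_le`).  Given
(β), (γ) and the model signs, `Thm314SupOn` (restricted, M-uniform) ⇒ `Thm314Printed` (unrestricted, M-uniform) with δ₀ ↦ min(δ₀, ½δ₁) and
B₀ ↦ max(B₀, B₁e^{δ₀′r}) — constants still functions of the input constants only, so PART (ii) OF THE FLAG (M-uniformity of the adjusted δ₀, the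
content of `B9Thm314.Thm314SupDep` vs `Thm314SupOn`, GAPS G-B9-08 ∕ G-B9-19 ∕ G-pv05-1) IS UNTOUCHED and remains the only typing-strength question
on `t314` ∕ `t314loc`.

WHAT IS PROVED (kernel; no `sorry`; nothing of [B9] asserted — every analytic input is a displayed hypothesis of printed shape):
* (private) `exp_split_offRestriction` — the arithmetic e^{−δ₁d} ≤ e^{δ′r}·e^{−δ′d}·e^{−δ′d_Ω} for 2δ′ ≤ δ₁, d ≥ 0, d_Ω ≤ d + r;
* (private) `mono_twoFactor` — weakening of a bound c·p·e^{−δd}·e^{−δd_Ω}·m in the constant and the rate;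
* `thm314Printed_of_supOn` — `Thm314SupOn` + (β) + (γ) + signs ⇒ `B9.Thm314Printed`;
* `thm314Printed_of_local` — the same from the leaf's local reading `B9Thm314.Thm314LocalPrinted` (via `B9Thm314.supOn_of_local`).

HONEST FRAMING: typing-strength bookkeeping for one field of the N06 leaf; count-neutral; N06 NOT discharged; nothing continuum ∕ ℝ⁴ ∕ OS ∕ mass-gap ∕
Clay.
-/

namespace Literature.MathematicalPhysics.QuantumFieldTheory.Balaban1983to89.B9Thm314Unrestricted

open Literature.MathematicalPhysics.QuantumFieldTheory.Balaban1983to89.B9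
open Literature.MathematicalPhysics.QuantumFieldTheory.Balaban1983to89.B9Thm314

/-! ## §1 Arithmetic -/

/-- Off the restriction: a plain decay e^{−δ₁d(y,y′)} pays for the extra factor e^{−δ′d(y,y′,Ω)} at half the rate and the constant e^{δ′r}, as soon
as d(y, y′, Ω) ≤ d(y, y′) + r. [folklore] -/
private theorem exp_split_offRestriction {δ δ₁ d dΩ r : ℝ} (hδ : 0 ≤ δ) (h2 : 2 * δ ≤ δ₁) (hd : 0 ≤ d) (hΩ : dΩ ≤ d + r) :
    Real.exp (-(δ₁ * d)) ≤ Real.exp (δ * r) * (Real.exp (-(δ * d)) * Real.exp (-(δ * dΩ))) := by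
  rw [← Real.exp_add, ← Real.exp_add]
  apply Real.exp_le_exp.2
  nlinarith [mul_nonneg (sub_nonneg.2 h2) hd, mul_nonneg hδ (sub_nonneg.2 hΩ)]

/-- Weakening of a bound of the shape q ≤ c·p·e^{−δt}·e^{−δu}·m in the constant (c ≤ c′) and the rate (δ′ ≤ δ), for p, m, t, u ≥ 0. [folklore] -/
private theorem mono_twoFactor {q c c' p δ δ' t u m : ℝ} (h : q ≤ c * p * Real.exp (-(δ * t)) * Real.exp (-(δ * u)) * m)
    (hc : c ≤ c') (hc' : 0 ≤ c') (hp : 0 ≤ p) (hm : 0 ≤ m) (hδ : δ' ≤ δ) (ht : 0 ≤ t) (hu : 0 ≤ u) :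
    q ≤ c' * p * Real.exp (-(δ' * t)) * Real.exp (-(δ' * u)) * m := by
  refine h.trans ?_
  have e1 : Real.exp (-(δ * t)) ≤ Real.exp (-(δ' * t)) := B9FromB6.decay_mono hδ ht
  have e2 : Real.exp (-(δ * u)) ≤ Real.exp (-(δ' * u)) := B9FromB6.decay_mono hδ hu
  have h1 : c * p ≤ c' * p := mul_le_mul_of_nonneg_right hc hp
  have h2 : c * p * Real.exp (-(δ * t)) ≤ c' * p * Real.exp (-(δ' * t)) :=
    mul_le_mul h1 e1 (Real.exp_nonneg _) (mul_nonneg hc' hp)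
  have h3 : c * p * Real.exp (-(δ * t)) * Real.exp (-(δ * u)) ≤ c' * p * Real.exp (-(δ' * t)) * Real.exp (-(δ' * u)) :=
    mul_le_mul h2 e2 (Real.exp_nonneg _) (mul_nonneg (mul_nonneg hc' hp) (Real.exp_nonneg _))
  exact mul_le_mul_of_nonneg_right h3 hm

/-! ## §2 The unrestricted reading from the restricted one -/

section Statement

variable {I : Type} {c35 : ℝ} {geo : I → Geometry} {bg : I → Backgrounds}
  {Kdiff : ∀ i, KernelFamily (geo i) (bg i)} {OmK : ∀ i, (geo i).Site → Prop}
  {dOmega : ∀ i, (geo i).Site → (geo i).Site → ℝ}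

/-- **Theorem 3.14 typed WITHOUT the localisation restriction (`B9.Thm314Printed`, M-uniform sup reading) ⇐ the printed RESTRICTED reading
(`Thm314SupOn`, M-uniform)**, given: the model signs of the lattice quantities (3.39)–(3.41) (`B9FromB6.ModelSigns`) and `d(y, y′, Ω) ≥ 0`;
(γ) the located geometric input — off the restriction the distance (3.154) exceeds the multiscale distance by at most `r`; (β) the PLAIN
characteristic sup bound (3.42) for the difference operator with no extra factor, under thresholds of the same kind (at Bałaban's objects: Theorem 3.1
for both operators + triangle inequality).  Constants: M₅ ↦ max, a₀ ↦ min, δ₀ ↦ min(δ₀, ½δ₁), B₀ ↦ max(B₀, B₁e^{δ₀′r}). [cite: Balaban1985BackgroundPropagators, Thm 3.14 (3.154) pp.426–427 (bookkeeping: restricted ⇒ unrestricted typed reading)] -/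
theorem thm314Printed_of_supOn (S : ∀ i, B9FromB6.ModelSigns (geo i)) (hΩ : ∀ (i : I) (y y' : (geo i).Site), 0 ≤ dOmega i y y')
    (r : ℝ) (hgeo : ∀ (i : I) (y y' : (geo i).Site), ¬ (OmK i y ∧ OmK i y') → dOmega i y y' ≤ (geo i).dist y y' + r)
    (hOn : Thm314SupOn c35 geo bg Kdiff OmK dOmega)
    (hplain : ∃ M₁ δ₁ a₁ B₁ : ℝ, 0 < M₁ ∧ 0 < δ₁ ∧ 0 < a₁ ∧ 0 < B₁ ∧
      ∀ i : I, M₁ ≤ (geo i).M → ∀ α₀ : ℝ, 0 < α₀ → (geo i).M * α₀ ≤ a₁ →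
        ∀ U : (bg i).Cfg, (bg i).Reg335 c35 α₀ U → IneqSupF (Kdiff i) B₁ δ₁ (fun _ => True) (fun _ _ => 1) U) :
    Thm314Printed c35 geo bg Kdiff dOmega := by
  obtain ⟨M₅, δ, a₀, B, hM5, hδ, ha0, hB, H⟩ := hOn
  obtain ⟨M₁, δ₁, a₁, B₁, hM1, hδ1, ha1, hB1, H1⟩ := hplain
  have hδ' : 0 < min δ (δ₁ / 2) := lt_min hδ (half_pos hδ1)
  have hδ'δ : min δ (δ₁ / 2) ≤ δ := min_le_left _ _
  have h2δ' : 2 * min δ (δ₁ / 2) ≤ δ₁ := by linarith [min_le_right δ (δ₁ / 2)]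
  refine ⟨max M₅ M₁, min δ (δ₁ / 2), min a₀ a₁, max B (B₁ * Real.exp (min δ (δ₁ / 2) * r)), lt_max_of_lt_left hM5, hδ',
    lt_min ha0 ha1, lt_max_of_lt_left hB, ?_⟩
  intro i hMi α₀ hα hMa U hU n lam y y' hs
  have hpref : 0 ≤ pref4 ((geo i).len y) n := B9FromB6.pref4_nonneg (B9FromB6.len_nonneg (S i) y) n
  have hsup : 0 ≤ (geo i).supNorm lam := (S i).supNorm_nonneg lam
  have hd : 0 ≤ (geo i).dist y y' := (S i).dist_nonneg y y'
  have hB' : 0 ≤ max B (B₁ * Real.exp (min δ (δ₁ / 2) * r)) := le_trans hB.le (le_max_left _ _)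
  by_cases hyy : OmK i y ∧ OmK i y'
  · -- on the restriction: Theorem 3.14 as printed, rate weakened
    have h := H i (le_trans (le_max_left _ _) hMi) α₀ hα (le_trans hMa (min_le_left _ _)) U hU n lam y y' hyy.1 hyy.2 hs
    exact mono_twoFactor h (le_max_left _ _) hB' hpref hsup hδ'δ hd (hΩ i y y')
  · -- off the restriction: the plain bound pays for the extra factor through (γ)
    have h := H1 i (le_trans (le_max_right _ _) hMi) α₀ hα (le_trans hMa (min_le_right _ _)) U hU n lam y y' trivial trivial hs
    have key := exp_split_offRestriction hδ'.le h2δ' hd (hgeo i y y' hyy)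
    have hBB : B₁ * Real.exp (min δ (δ₁ / 2) * r) ≤ max B (B₁ * Real.exp (min δ (δ₁ / 2) * r)) := le_max_right _ _
    calc (Kdiff i).e n U lam y
        ≤ B₁ * pref4 ((geo i).len y) n * Real.exp (-(δ₁ * (geo i).dist y y')) * 1 * (geo i).supNorm lam := h
      _ ≤ B₁ * pref4 ((geo i).len y) n * (Real.exp (min δ (δ₁ / 2) * r) *
            (Real.exp (-(min δ (δ₁ / 2) * (geo i).dist y y')) * Real.exp (-(min δ (δ₁ / 2) * dOmega i y y')))) * 1 *
            (geo i).supNorm lam := by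
          apply mul_le_mul_of_nonneg_right _ hsup
          apply mul_le_mul_of_nonneg_right _ zero_le_one
          exact mul_le_mul_of_nonneg_left key (mul_nonneg hB1.le hpref)
      _ = B₁ * Real.exp (min δ (δ₁ / 2) * r) * pref4 ((geo i).len y) n * Real.exp (-(min δ (δ₁ / 2) * (geo i).dist y y')) *
            Real.exp (-(min δ (δ₁ / 2) * dOmega i y y')) * (geo i).supNorm lam := by ring
      _ ≤ max B (B₁ * Real.exp (min δ (δ₁ / 2) * r)) * pref4 ((geo i).len y) n * Real.exp (-(min δ (δ₁ / 2) * (geo i).dist y y')) *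
            Real.exp (-(min δ (δ₁ / 2) * dOmega i y y')) * (geo i).supNorm lam := by
          apply mul_le_mul_of_nonneg_right _ hsup
          apply mul_le_mul_of_nonneg_right _ (Real.exp_nonneg _)
          apply mul_le_mul_of_nonneg_right _ (Real.exp_nonneg _)
          exact mul_le_mul_of_nonneg_right hBB hpref

/-- **The same from the leaf's LOCAL reading** `B9Thm314.Thm314LocalPrinted` (sup + L² + Hölder entries on the restriction; the `t314loc` field of
`DagBinding.B9LeafX`): its sup part (`B9Thm314.supOn_of_local`) together with (β), (γ) and the signs gives the unrestricted `B9.Thm314Printed`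
(the `t314` field) — so at a pin supplying (β) and (γ) the field `t314` carries no content beyond `t314loc` except the M-uniformity question it
shares with it. [cite: Balaban1985BackgroundPropagators, Thm 3.14 (3.154) pp.426–427 (bookkeeping)] -/
theorem thm314Printed_of_local (S : ∀ i, B9FromB6.ModelSigns (geo i)) (hΩ : ∀ (i : I) (y y' : (geo i).Site), 0 ≤ dOmega i y y')
    (r : ℝ) (hgeo : ∀ (i : I) (y y' : (geo i).Site), ¬ (OmK i y ∧ OmK i y') → dOmega i y y' ≤ (geo i).dist y y' + r)
    (hloc : Thm314LocalPrinted c35 geo bg Kdiff OmK dOmega)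
    (hplain : ∃ M₁ δ₁ a₁ B₁ : ℝ, 0 < M₁ ∧ 0 < δ₁ ∧ 0 < a₁ ∧ 0 < B₁ ∧
      ∀ i : I, M₁ ≤ (geo i).M → ∀ α₀ : ℝ, 0 < α₀ → (geo i).M * α₀ ≤ a₁ →
        ∀ U : (bg i).Cfg, (bg i).Reg335 c35 α₀ U → IneqSupF (Kdiff i) B₁ δ₁ (fun _ => True) (fun _ _ => 1) U) :
    Thm314Printed c35 geo bg Kdiff dOmega :=
  thm314Printed_of_supOn S hΩ r hgeo (supOn_of_local hloc) hplain

end Statement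

end Literature.MathematicalPhysics.QuantumFieldTheory.Balaban1983to89.B9Thm314Unrestricted
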